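import Summits.BirchSwinnertonDyer.BirchSwinnertonDyer.Theorems.KolyvaginDepthDoorDepthTableCruxAtCurve1
import Summits.BirchSwinnertonDyer.BirchSwinnertonDyer.Theorems.KolyvaginDepthDoorDepthTableRows2
import Summits.BirchSwinnertonDyer.BirchSwinnertonDyer.Theorems.KolyvaginDepthDoorDepthTableRows4
import Summits.BirchSwinnertonDyer.BirchSwinnertonDyer.Theorems.KolyvaginDepthDoorDepthTableRows5
import Summits.BirchSwinnertonDyer.BirchSwinnertonDyer.Theorems.KolyvaginDepthDoorDepthTableAdditiveSurjectivityA
import Summits.BirchSwinnertonDyer.BirchSwinnertonDyer.Theorems.KolyvaginDepthDoorDepthTableAdditiveSurjectivityB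
import Summits.BirchSwinnertonDyer.BirchSwinnertonDyer.Theorems.ErratumRoadFiveKolyvaginFramesTight
import HarnessLib

/-!
# Route `KolyvaginDepthDoor` — the depth table in POINT-CERTIFICATE form: the row hypothesis
# `c_1(ℓ) ≠ 0` replaced by what the Jetchev–Lauter–Stein algorithm actually decides,
# `P(ℓ) ∉ p·E(K[ℓ])` (crux `KolyvaginDepthSupply`, stmt-BirchSwinnertonDyer-21765)

Helper file (`--supports stmt-BirchSwinnertonDyer-21765 --as helper`); it closes nothing and BSD is
not proved by it. HONEST FRAMING: per-curve theorems; each row stays CONDITIONAL on Kolyvagin 1991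
Thm. 4 (`hF`) and on ONE computed bit — now the bit is a pure point-divisibility statement about the
derived Heegner point, with no cohomology in it.

The tree's depth-table rows (g2: `C<label>.depthRow_p_negD_ℓ`, `C<label>.kolyvaginDepthSupply_clause`;
kit `depthRow_of_intModel_certificate`) take the bit as `c_1(ℓ) ≠ 0 ∈ H¹(K, E[p])` for a
Kolyvagin–Heegner datum `d` of conductor `ℓ`. What the instrument COMPUTES (Jetchev–Lauter–Stein,
arXiv:0707.0032 §3.2: "the class `κ_{c,m}` is non-trivial iff `P_c ∉ p^m E(K[c])`"; §3.6: the
`p`-division-polynomial test over `K[ℓ]`, degree `(ℓ+1)h_K`) is the NON-DIVISIBILITY of the derived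
point `P(ℓ) = Σ iσⁱ y_ℓ` by `p` in `E(K[ℓ])` — in the tree's vocabulary `¬ Koly.PDiv (d ℓ) p 1`
(`Koly.PDiv d p M := ∃ Q ∈ E(K[n]), p^M • Q = P(n)`, McCallum 1991 §5). The passage "point
certificate ⟹ non-zero class" at odd `p` with `ρ̄_{E,p}` onto is the tree theorem
`Koly.kolyvaginClass_ne_zero_of_tower_not_pDiv_of_surj` (McCallum Cor. 4.5 with Gross Lemma 4.3 for
admissibility and the Euler-system relations, Gross Prop. 3.6, for the `Γ_K`-invariance of `[P(ℓ)]`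
— the latter is why the datum must come as a TOWER `d m` over the divisors `m ∣ ℓ`, i.e. `d 1` and
`d ℓ` on one frame). This file composes:

* `kolyvaginClass_ne_zero_of_intModel_certificate_of_tower` — generic: the row kit's integer-model
  certificates (`ρ̄_{E,p}` onto, `d_K = D < −4` Heegner for `N_E`, `ℓ` a Kolyvagin prime read off the
  point count) + a tower `d` over `{1, ℓ}` + `P(ℓ) ∉ p·E(K[ℓ])` ⟹ `c_1(ℓ) ≠ 0`.
* `depthRow_of_intModel_certificate_of_tower`, `kolyvaginDepthSupply_clause_of_intModel_certificate_of_tower`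
  — the row kit's ROW (`t_p = 0 ∧ rank = 2 ∧ s_p = 2 ∧ s_p(E^{(D)}) = 1`) and the crux's CLAUSE at
  `W`, from the point certificate instead of the class bit.
* `C<label>.kolyvaginClass_ne_zero_of_tower` for the 18 depth-table curves at their `(p, d_K, ℓ)`
  (rows 1–6 here, rows 7–18 in the sequel `KolyvaginDepthDoorDepthTablePointCert2`)
  (every side condition a kernel theorem of g2's row files): `P(ℓ) ∉ p·E(K[ℓ]) ⟹ c_1(ℓ) ≠ 0`; feed it
  to `C<label>.depthRow_p_negD_ℓ` / `C<label>.kolyvaginDepthSupply_clause` (shown for `389a1`: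
  `C389a1.depthRow_5_neg7_19_of_tower`, `C389a1.kolyvaginDepthSupply_clause_of_tower`).

So the compute seat's deliverable per row is literally: a frame `(Dt, β, ι)`, Kolyvagin–Heegner data
at conductors `1` and `ℓ` on it, and the verified statement "no `Q ∈ E(K[ℓ])` with `p·Q = P(ℓ)`".

References: [JetchevLauterStein2009] arXiv:0707.0032 §3.2, §3.6, Prop. 3.10; [McCallumLMS1991]
§4 (4)–(5), Cor. 4.5, §5; [GrossLMS1991] Prop. 3.6, Lemma 4.3, Prop. 4.7 (1); [Kolyvagin1991MathAnn]
§2 Thm. 4; [WZhang2014] Notations (xii), Thm. 11.2 (i); [CremonaAlgorithms1997] Table 1.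
-/

set_option linter.dupNamespace false

noncomputable section

open scoped Classical NumberField

namespace Summit.BirchSwinnertonDyer.BirchSwinnertonDyer.Theorems.KolyvaginDepthDoor

open Literature.NumberTheory.EllipticCurves Literature.NumberTheory.EllipticCurves.ModularForms
  WeierstrassCurve
open Summit.BirchSwinnertonDyer.BirchSwinnertonDyer.Rank2Observatory
open Summit.BirchSwinnertonDyer.BirchSwinnertonDyer.Rank1Residual
open Summit.BirchSwinnertonDyer.Rank1Residual.X11b.Three

/-! ## §1 Generic: the row kit with a point certificate instead of the class bit -/

section Generic

variable {W : WeierstrassCurve ℚ} [W.IsElliptic] [W.IsGloballyMinimal] {E₀ : WeierstrassCurve ℤ}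
  (hI : integralModelInt W = E₀)
include hI

/-- **Point certificate ⟹ non-zero class, on integer-model certificates.** `W/ℚ` globally minimal with
integral model `E₀`; an odd prime `p` with `ρ̄_{E,p}` onto; `K` imaginary quadratic of discriminant
`D < −4` in which every prime of `Δ(E₀)` splits (Heegner hypothesis for `N_E`); an odd prime
`ℓ ∤ Δ(E₀) D`, `ℓ ≠ p`, `(D/ℓ) = −1`, `p ∣ ℓ + 1`, `p ∣ a_ℓ` (a Kolyvagin prime, W. Zhang's (xii));
a frame `(Dt, β, ι)` and Kolyvagin–Heegner data `d m` at the divisors `m ∣ ℓ`. If the derived point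
`P(ℓ)` of `d ℓ` is not `p`-divisible in `E(K[ℓ])`, then `c_1(ℓ) ≠ 0`
(`Koly.kolyvaginClass_ne_zero_of_tower_not_pDiv_of_surj`: McCallum Cor. 4.5, Gross Lemma 4.3,
Prop. 3.6). [cite: JetchevLauterStein2009, §3.2 (arXiv:0707.0032)] [cite: McCallumLMS1991, §4 Cor. 4.5]
[cite: GrossLMS1991, Prop. 3.6 and Lemma 4.3] -/
theorem kolyvaginClass_ne_zero_of_intModel_certificate_of_tower
    (p : ℕ) [hp : Fact p.Prime] (hp2 : p ≠ 2) (hsurj : W.HasSurjectiveModNGaloisRep p)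
    (K : Type) [Field K] [NumberField K] (hK : IsImaginaryQuadratic K) {D : ℤ}
    (hD : NumberField.discr K = D) (hD4 : D < -4)
    (hH : ∀ q : ℕ, q.Prime → (q : ℤ) ∣ E₀.Δ → (q = 2 → D % 8 = 1) ∧ (q ≠ 2 → jacobiSym D q = 1))
    (ℓ : ℕ) (hℓ : ℓ.Prime) (hℓ2 : ℓ ≠ 2) (hℓΔ : ¬ (ℓ : ℤ) ∣ E₀.Δ) (hℓD : ¬ (ℓ : ℤ) ∣ D)
    (hℓp : ℓ ≠ p) (hjac : jacobiSym D ℓ = -1) (hℓ1 : p ∣ ℓ + 1) {n : ℕ}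
    (hcard : Nat.card ((E₀.map (Int.castRingHom (ZMod ℓ))).toAffine.Point) = n)
    (haℓ : (p : ℤ) ∣ (ℓ : ℤ) + 1 - n)
    [NeZero (W.conductorNorm ℤ)] (Dt : ModularParametrizationData W (W.conductorNorm ℤ)) (β : ℤ)
    (ι : K →+* ℂ) (d : (m : ℕ) → m ∣ ℓ → KolyvaginHeegnerData Dt β ι m)
    (hcert : ¬ Koly.PDiv (d ℓ dvd_rfl) p 1) :
    (d ℓ dvd_rfl).kolyvaginClass hp.out 1 ≠ 0 := by
  obtain ⟨hkol, -⟩ := isKolyvaginPrime_of_intModel_certificate hI p K hK.1 hD ℓ hℓ hℓ2 hℓΔ hℓD hℓp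
    hjac hℓ1 hcard haℓ
  exact Koly.kolyvaginClass_ne_zero_of_tower_not_pDiv_of_surj W K Dt β ι p hp2 hsurj hK
    (satisfiesHeegnerHypothesis_conductorNorm_of_intModel hI K hK.1 hD hH) (by rw [hD]; exact hD4)
    (KolyvaginDescent.kolSupp_prime hℓ hkol) d hcert

/-- **The depth-table ROW from a point certificate (modulo Kolyvagin 1991 Thm. 4).** The row kit's
`depthRow_of_intModel_certificate` with its input `c_1(ℓ) ≠ 0` replaced by a tower `d m (m ∣ ℓ)` of
Kolyvagin–Heegner data and `P(ℓ) ∉ p·E(K[ℓ])`; extra input `D < −4`. Output: `corank_ℤ_p Ш(E)[p^∞] = 0`,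
`rank_ℤ E(ℚ) = 2`, `corank Sel_{p^∞}(E/ℚ) = 2`, `corank Sel_{p^∞}(E^{(D)}/ℚ) = 1`. Per-curve; conditional
on `hF` and on the computed point certificate; BSD is not proved by it.
[cite: Kolyvagin1991MathAnn, §2 Thm. 4] [cite: JetchevLauterStein2009, §3.2 and §3.6 (arXiv:0707.0032)] -/
theorem depthRow_of_intModel_certificate_of_tower
    (hF : Kolyvagin1991_selmerCorank_of_kolyvaginClass_ne_zero) (hr : 2 ≤ W.mordellWeilRank)
    (p : ℕ) [hp : Fact p.Prime] (h5 : 5 ≤ p) (hpΔ : ¬ (p : ℤ) ∣ E₀.Δ)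
    (hsurj : W.HasSurjectiveModNGaloisRep p)
    (K : Type) [Field K] [NumberField K] (hK : IsImaginaryQuadratic K) {D : ℤ}
    (hD : NumberField.discr K = D) (h3 : D ≠ -3) (h4 : D ≠ -4) (hpD : ¬ (p : ℤ) ∣ D) (hD4 : D < -4)
    (hH : ∀ q : ℕ, q.Prime → (q : ℤ) ∣ E₀.Δ → (q = 2 → D % 8 = 1) ∧ (q ≠ 2 → jacobiSym D q = 1))
    (ℓ : ℕ) (hℓ : ℓ.Prime) (hℓ2 : ℓ ≠ 2) (hℓΔ : ¬ (ℓ : ℤ) ∣ E₀.Δ) (hℓD : ¬ (ℓ : ℤ) ∣ D)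
    (hℓp : ℓ ≠ p) (hjac : jacobiSym D ℓ = -1) (hℓ1 : p ∣ ℓ + 1) {n : ℕ}
    (hcard : Nat.card ((E₀.map (Int.castRingHom (ZMod ℓ))).toAffine.Point) = n)
    (haℓ : (p : ℤ) ∣ (ℓ : ℤ) + 1 - n)
    [NeZero (W.conductorNorm ℤ)] (Dt : ModularParametrizationData W (W.conductorNorm ℤ)) (β : ℤ)
    (ι : K →+* ℂ) (d : (m : ℕ) → m ∣ ℓ → KolyvaginHeegnerData Dt β ι m)
    (hcert : ¬ Koly.PDiv (d ℓ dvd_rfl) p 1) :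
    W.shaCorank p = 0 ∧ W.mordellWeilRank = 2 ∧ W.selmerCorank p = 2 ∧
      (W.quadraticTwist (D : ℚ)).selmerCorank p = 1 :=
  depthRow_of_intModel_certificate hI hF hr p h5 hpΔ hsurj K hK hD h3 h4 hpD hH ℓ hℓ hℓ2 hℓΔ hℓD hℓp
    hjac hℓ1 hcard haℓ Dt β ι (d ℓ dvd_rfl)
    (kolyvaginClass_ne_zero_of_intModel_certificate_of_tower hI p (by omega) hsurj K hK hD hD4 hH ℓ hℓ
      hℓ2 hℓΔ hℓD hℓp hjac hℓ1 hcard haℓ Dt β ι d hcert)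

/-- **The crux's CLAUSE at `W` from a point certificate (modulo Kolyvagin 1991 Thm. 4).** g2's
`kolyvaginDepthSupply_clause_of_intModel_certificate` with `c_1(ℓ) ≠ 0` replaced by a tower of
Kolyvagin–Heegner data over `{1, ℓ}` and `P(ℓ) ∉ p·E(K[ℓ])` (plus `D < −4` and the ordinary
certificate `p ∤ a_p`): the clause of `KolyvaginDepthSupply` at `W`, verbatim. Per-curve; conditional
on `hF` and the computed point certificate; BSD is not proved by it.
[cite: Kolyvagin1991MathAnn, §2 Thm. 4] [cite: JetchevLauterStein2009, §3.2 and §3.6 (arXiv:0707.0032)]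
[cite: WZhang2014, Thm. 11.2 (i) (p. 248)] -/
theorem kolyvaginDepthSupply_clause_of_intModel_certificate_of_tower
    (hF : Kolyvagin1991_selmerCorank_of_kolyvaginClass_ne_zero) (hr : 2 ≤ W.mordellWeilRank)
    (p : ℕ) [hp : Fact p.Prime] (h5 : 5 ≤ p) (hpΔ : ¬ (p : ℤ) ∣ E₀.Δ) {np : ℕ}
    (hcardp : Nat.card ((E₀.map (Int.castRingHom (ZMod p))).toAffine.Point) = np)
    (hord : ¬ (p : ℤ) ∣ (p : ℤ) + 1 - np) (hsurj : W.HasSurjectiveModNGaloisRep p)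
    (K : Type) [Field K] [NumberField K] (hK : IsImaginaryQuadratic K) {D : ℤ}
    (hD : NumberField.discr K = D) (h3 : D ≠ -3) (h4 : D ≠ -4) (hpD : ¬ (p : ℤ) ∣ D) (hD4 : D < -4)
    (hH : ∀ q : ℕ, q.Prime → (q : ℤ) ∣ E₀.Δ → (q = 2 → D % 8 = 1) ∧ (q ≠ 2 → jacobiSym D q = 1))
    (ℓ : ℕ) (hℓ : ℓ.Prime) (hℓ2 : ℓ ≠ 2) (hℓΔ : ¬ (ℓ : ℤ) ∣ E₀.Δ) (hℓD : ¬ (ℓ : ℤ) ∣ D)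
    (hℓp : ℓ ≠ p) (hjac : jacobiSym D ℓ = -1) (hℓ1 : p ∣ ℓ + 1) {n : ℕ}
    (hcard : Nat.card ((E₀.map (Int.castRingHom (ZMod ℓ))).toAffine.Point) = n)
    (haℓ : (p : ℤ) ∣ (ℓ : ℤ) + 1 - n)
    [NeZero (W.conductorNorm ℤ)] (Dt : ModularParametrizationData W (W.conductorNorm ℤ)) (β : ℤ)
    (ι : K →+* ℂ) (d : (m : ℕ) → m ∣ ℓ → KolyvaginHeegnerData Dt β ι m)
    (hcert : ¬ Koly.PDiv (d ℓ dvd_rfl) p 1) :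
    ∃ (p : ℕ) (hp : Fact p.Prime), 5 ≤ p ∧ W.HasGoodReductionAtPrime p ∧ ¬ (p : ℤ) ∣
      W.frobeniusTrace p ∧ W.HasSurjectiveModNGaloisRep p ∧ ∃ (K : Type) (_ : Field K) (_ :
      NumberField K), Literature.NumberTheory.EllipticCurves.IsImaginaryQuadratic K ∧
      NumberField.discr K ≠ -3 ∧ NumberField.discr K ≠ -4 ∧ ¬ ((p : ℤ) ∣ NumberField.discr K) ∧ ¬ (p
      ∣ W.conductorNorm ℤ) ∧ ∃ (_ : NeZero (W.conductorNorm ℤ)),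
      Literature.NumberTheory.EllipticCurves.SatisfiesHeegnerHypothesis (W.conductorNorm ℤ) K ∧ ∃
      (Dt : Literature.NumberTheory.EllipticCurves.ModularForms.ModularParametrizationData W
      (W.conductorNorm ℤ)) (β : ℤ) (ι : K →+* ℂ) (n : ℕ) (d :
      Literature.NumberTheory.EllipticCurves.KolyvaginHeegnerData Dt β ι n) (M : ℕ),
      Literature.NumberTheory.EllipticCurves.KolyvaginDescent.KolSupp
      (Literature.NumberTheory.EllipticCurves.Zhang2014.IsKolyvaginPrime (W.conductorNorm ℤ) W K p)
      n ∧ 1 ≤ M ∧ (M : ℕ∞) ≤ Literature.NumberTheory.EllipticCurves.Zhang2014.levelIndex W p n ∧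
      d.kolyvaginClass hp.out M ≠ 0 ∧ (∀ (n' : ℕ) (d' :
      Literature.NumberTheory.EllipticCurves.KolyvaginHeegnerData Dt β ι n') (M' : ℕ),
      Literature.NumberTheory.EllipticCurves.KolyvaginDescent.KolSupp
      (Literature.NumberTheory.EllipticCurves.Zhang2014.IsKolyvaginPrime (W.conductorNorm ℤ) W K p)
      n' → 1 ≤ M' → (M' : ℕ∞) ≤ Literature.NumberTheory.EllipticCurves.Zhang2014.levelIndex W p n' →
      d'.kolyvaginClass hp.out M' ≠ 0 → n.primeFactors.card ≤ n'.primeFactors.card) ∧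
      ((n.primeFactors.card + 1 = W.mordellWeilRank ∧ (W.quadraticTwist (NumberField.discr K :
      ℚ)).mordellWeilRank < W.mordellWeilRank) ∨ (n.primeFactors.card = W.mordellWeilRank ∧
      (W.quadraticTwist (NumberField.discr K : ℚ)).mordellWeilRank = W.mordellWeilRank + 1)) :=
  kolyvaginDepthSupply_clause_of_intModel_certificate hI hF hr p h5 hpΔ hcardp hord hsurj K hK hD h3 h4
    hpD hH ℓ hℓ hℓ2 hℓΔ hℓD hℓp hjac hℓ1 hcard haℓ Dt β ι (d ℓ dvd_rfl)
    (kolyvaginClass_ne_zero_of_intModel_certificate_of_tower hI p (by omega) hsurj K hK hD hD4 hH ℓ hℓ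
      hℓ2 hℓΔ hℓD hℓp hjac hℓ1 hcard haℓ Dt β ι d hcert)

end Generic

/-! ## §2 Depth-table rows 1–6 (`389a1 … 643a1`): point certificate ⟹ the row's bit `c_1(ℓ) ≠ 0`
(rows 7–18 in the sequel file `KolyvaginDepthDoorDepthTablePointCert2`) -/

namespace C389a1

/-- **Row `389a1` `(p, d_K, ℓ) = (5, -7, 19)`, POINT-CERTIFICATE form:** for `d_K = -7`, a frame and a
tower `d m` (`m ∣ 19`) of Kolyvagin–Heegner data, `P(19) ∉ 5·E(K[19])` ⟹ `c_1(19) ≠ 0` (the bit of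
`C389a1.depthRow_5_neg7_19` / `.kolyvaginDepthSupply_clause`; side conditions: kernel theorems of the row files).
[cite: JetchevLauterStein2009, §3.2 and §3.6 (arXiv:0707.0032)] [cite: McCallumLMS1991, §4 Cor. 4.5] -/
theorem kolyvaginClass_ne_zero_of_tower (K : Type) [Field K] [NumberField K]
    (hK : IsImaginaryQuadratic K) (hD : NumberField.discr K = -7) :
    haveI := curve389a1_isGloballyMinimal;
    haveI := curve389a1_neZero_conductorNorm;
    ∀ (Dt : ModularParametrizationData Curve389a1.E (Curve389a1.E.conductorNorm ℤ)) (β : ℤ)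
    (ι : K →+* ℂ) (d : (m : ℕ) → m ∣ 19 → KolyvaginHeegnerData Dt β ι m),
    ¬ Koly.PDiv (d 19 dvd_rfl) 5 1 → (d 19 dvd_rfl).kolyvaginClass (p := 5) (by norm_num) 1 ≠ 0 := by
  haveI := curve389a1_isGloballyMinimal
  haveI := curve389a1_neZero_conductorNorm
  intro Dt β ι d hcert
  haveI := Fact.mk (by norm_num : Nat.Prime 5)
  exact kolyvaginClass_ne_zero_of_intModel_certificate_of_tower intModel 5 (by norm_num) hasSurjectiveModNGaloisRep_5 K hK
    hD (by norm_num) heegner_neg7 19 (by norm_num) (by norm_num) (by decide +kernel) (by norm_num) (by norm_num) (by norm_num) (by norm_num)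
    (n := 15) card_19 (by norm_num) Dt β ι d hcert

end C389a1

namespace C433a1

/-- **Row `433a1` `(p, d_K, ℓ) = (5, -8, 79)`, POINT-CERTIFICATE form:** for `d_K = -8`, a frame and a
tower `d m` (`m ∣ 79`) of Kolyvagin–Heegner data, `P(79) ∉ 5·E(K[79])` ⟹ `c_1(79) ≠ 0` (the bit of
`C433a1.depthRow_5_neg8_79` / `.kolyvaginDepthSupply_clause`; side conditions: kernel theorems of the row files).
[cite: JetchevLauterStein2009, §3.2 and §3.6 (arXiv:0707.0032)] [cite: McCallumLMS1991, §4 Cor. 4.5] -/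
theorem kolyvaginClass_ne_zero_of_tower (K : Type) [Field K] [NumberField K]
    (hK : IsImaginaryQuadratic K) (hD : NumberField.discr K = -8) :
    haveI := isElliptic_c433a1;
    haveI := isGloballyMinimal_c433a1;
    haveI : NeZero (((⟨1, 0, 0, 0, 1⟩ : WeierstrassCurve ℤ).map (Int.castRingHom ℚ)).conductorNorm ℤ) := neZero_conductorNorm_of_isElliptic _;
    ∀ (Dt : ModularParametrizationData ((⟨1, 0, 0, 0, 1⟩ : WeierstrassCurve ℤ).map (Int.castRingHom ℚ)) (((⟨1, 0, 0, 0, 1⟩ : WeierstrassCurve ℤ).map (Int.castRingHom ℚ)).conductorNorm ℤ)) (β : ℤ)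
    (ι : K →+* ℂ) (d : (m : ℕ) → m ∣ 79 → KolyvaginHeegnerData Dt β ι m),
    ¬ Koly.PDiv (d 79 dvd_rfl) 5 1 → (d 79 dvd_rfl).kolyvaginClass (p := 5) (by norm_num) 1 ≠ 0 := by
  haveI := isElliptic_c433a1
  haveI := isGloballyMinimal_c433a1
  haveI : NeZero (((⟨1, 0, 0, 0, 1⟩ : WeierstrassCurve ℤ).map (Int.castRingHom ℚ)).conductorNorm ℤ) := neZero_conductorNorm_of_isElliptic _
  intro Dt β ι d hcert
  haveI := Fact.mk (by norm_num : Nat.Prime 5)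
  exact kolyvaginClass_ne_zero_of_intModel_certificate_of_tower intModel 5 (by norm_num) hasSurjectiveModNGaloisRep_5 K hK
    hD (by norm_num) heegner_neg8 79 (by norm_num) (by norm_num) (by decide +kernel) (by norm_num) (by norm_num) (by norm_num) (by norm_num)
    (n := 70) card_79 (by norm_num) Dt β ι d hcert

end C433a1

namespace C446d1

/-- **Row `446d1` `(p, d_K, ℓ) = (5, -23, 19)`, POINT-CERTIFICATE form:** for `d_K = -23`, a frame and a
tower `d m` (`m ∣ 19`) of Kolyvagin–Heegner data, `P(19) ∉ 5·E(K[19])` ⟹ `c_1(19) ≠ 0` (the bit of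
`C446d1.depthRow_5_neg23_19` / `.kolyvaginDepthSupply_clause`; side conditions: kernel theorems of the row files).
[cite: JetchevLauterStein2009, §3.2 and §3.6 (arXiv:0707.0032)] [cite: McCallumLMS1991, §4 Cor. 4.5] -/
theorem kolyvaginClass_ne_zero_of_tower (K : Type) [Field K] [NumberField K]
    (hK : IsImaginaryQuadratic K) (hD : NumberField.discr K = -23) :
    haveI := isElliptic_c446d1;
    haveI := isGloballyMinimal_c446d1;
    haveI : NeZero (((⟨1, -1, 0, -4, 4⟩ : WeierstrassCurve ℤ).map (Int.castRingHom ℚ)).conductorNorm ℤ) := neZero_conductorNorm_of_isElliptic _;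
    ∀ (Dt : ModularParametrizationData ((⟨1, -1, 0, -4, 4⟩ : WeierstrassCurve ℤ).map (Int.castRingHom ℚ)) (((⟨1, -1, 0, -4, 4⟩ : WeierstrassCurve ℤ).map (Int.castRingHom ℚ)).conductorNorm ℤ)) (β : ℤ)
    (ι : K →+* ℂ) (d : (m : ℕ) → m ∣ 19 → KolyvaginHeegnerData Dt β ι m),
    ¬ Koly.PDiv (d 19 dvd_rfl) 5 1 → (d 19 dvd_rfl).kolyvaginClass (p := 5) (by norm_num) 1 ≠ 0 := by
  haveI := isElliptic_c446d1
  haveI := isGloballyMinimal_c446d1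
  haveI : NeZero (((⟨1, -1, 0, -4, 4⟩ : WeierstrassCurve ℤ).map (Int.castRingHom ℚ)).conductorNorm ℤ) := neZero_conductorNorm_of_isElliptic _
  intro Dt β ι d hcert
  haveI := Fact.mk (by norm_num : Nat.Prime 5)
  exact kolyvaginClass_ne_zero_of_intModel_certificate_of_tower intModel 5 (by norm_num) hasSurjectiveModNGaloisRep_5 K hK
    hD (by norm_num) heegner_neg23 19 (by norm_num) (by norm_num) (by decide +kernel) (by norm_num) (by norm_num) (by norm_num) (by norm_num)
    (n := 20) card_19 (by norm_num) Dt β ι d hcert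

end C446d1

namespace C563a1

/-- **Row `563a1` `(p, d_K, ℓ) = (5, -8, 199)`, POINT-CERTIFICATE form:** for `d_K = -8`, a frame and a
tower `d m` (`m ∣ 199`) of Kolyvagin–Heegner data, `P(199) ∉ 5·E(K[199])` ⟹ `c_1(199) ≠ 0` (the bit of
`C563a1.depthRow_5_neg8_199` / `.kolyvaginDepthSupply_clause`; side conditions: kernel theorems of the row files).
[cite: JetchevLauterStein2009, §3.2 and §3.6 (arXiv:0707.0032)] [cite: McCallumLMS1991, §4 Cor. 4.5] -/
theorem kolyvaginClass_ne_zero_of_tower (K : Type) [Field K] [NumberField K]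
    (hK : IsImaginaryQuadratic K) (hD : NumberField.discr K = -8) :
    haveI := isElliptic_c563a1;
    haveI := isGloballyMinimal_c563a1;
    haveI : NeZero (((⟨1, 1, 1, -15, 16⟩ : WeierstrassCurve ℤ).map (Int.castRingHom ℚ)).conductorNorm ℤ) := neZero_conductorNorm_of_isElliptic _;
    ∀ (Dt : ModularParametrizationData ((⟨1, 1, 1, -15, 16⟩ : WeierstrassCurve ℤ).map (Int.castRingHom ℚ)) (((⟨1, 1, 1, -15, 16⟩ : WeierstrassCurve ℤ).map (Int.castRingHom ℚ)).conductorNorm ℤ)) (β : ℤ)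
    (ι : K →+* ℂ) (d : (m : ℕ) → m ∣ 199 → KolyvaginHeegnerData Dt β ι m),
    ¬ Koly.PDiv (d 199 dvd_rfl) 5 1 → (d 199 dvd_rfl).kolyvaginClass (p := 5) (by norm_num) 1 ≠ 0 := by
  haveI := isElliptic_c563a1
  haveI := isGloballyMinimal_c563a1
  haveI : NeZero (((⟨1, 1, 1, -15, 16⟩ : WeierstrassCurve ℤ).map (Int.castRingHom ℚ)).conductorNorm ℤ) := neZero_conductorNorm_of_isElliptic _
  intro Dt β ι d hcert
  haveI := Fact.mk (by norm_num : Nat.Prime 5)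
  exact kolyvaginClass_ne_zero_of_intModel_certificate_of_tower intModel 5 (by norm_num) hasSurjectiveModNGaloisRep_5 K hK
    hD (by norm_num) heegner_neg8 199 (by norm_num) (by norm_num) (by decide +kernel) (by norm_num) (by norm_num) (by norm_num) (by norm_num)
    (n := 220) card_199 (by norm_num) Dt β ι d hcert

end C563a1

namespace C571b1

/-- **Row `571b1` `(p, d_K, ℓ) = (5, -8, 29)`, POINT-CERTIFICATE form:** for `d_K = -8`, a frame and a
tower `d m` (`m ∣ 29`) of Kolyvagin–Heegner data, `P(29) ∉ 5·E(K[29])` ⟹ `c_1(29) ≠ 0` (the bit of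
`C571b1.depthRow_5_neg8_29` / `.kolyvaginDepthSupply_clause`; side conditions: kernel theorems of the row files).
[cite: JetchevLauterStein2009, §3.2 and §3.6 (arXiv:0707.0032)] [cite: McCallumLMS1991, §4 Cor. 4.5] -/
theorem kolyvaginClass_ne_zero_of_tower (K : Type) [Field K] [NumberField K]
    (hK : IsImaginaryQuadratic K) (hD : NumberField.discr K = -8) :
    haveI := isElliptic_c571b1;
    haveI := isGloballyMinimal_c571b1;
    haveI : NeZero (((⟨0, 1, 1, -4, 2⟩ : WeierstrassCurve ℤ).map (Int.castRingHom ℚ)).conductorNorm ℤ) := neZero_conductorNorm_of_isElliptic _;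
    ∀ (Dt : ModularParametrizationData ((⟨0, 1, 1, -4, 2⟩ : WeierstrassCurve ℤ).map (Int.castRingHom ℚ)) (((⟨0, 1, 1, -4, 2⟩ : WeierstrassCurve ℤ).map (Int.castRingHom ℚ)).conductorNorm ℤ)) (β : ℤ)
    (ι : K →+* ℂ) (d : (m : ℕ) → m ∣ 29 → KolyvaginHeegnerData Dt β ι m),
    ¬ Koly.PDiv (d 29 dvd_rfl) 5 1 → (d 29 dvd_rfl).kolyvaginClass (p := 5) (by norm_num) 1 ≠ 0 := by
  haveI := isElliptic_c571b1
  haveI := isGloballyMinimal_c571b1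
  haveI : NeZero (((⟨0, 1, 1, -4, 2⟩ : WeierstrassCurve ℤ).map (Int.castRingHom ℚ)).conductorNorm ℤ) := neZero_conductorNorm_of_isElliptic _
  intro Dt β ι d hcert
  haveI := Fact.mk (by norm_num : Nat.Prime 5)
  exact kolyvaginClass_ne_zero_of_intModel_certificate_of_tower intModel 5 (by norm_num) hasSurjectiveModNGaloisRep_5 K hK
    hD (by norm_num) heegner_neg8 29 (by norm_num) (by norm_num) (by decide +kernel) (by norm_num) (by norm_num) (by norm_num) (by norm_num)
    (n := 25) card_29 (by norm_num) Dt β ι d hcert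

end C571b1

namespace C643a1

/-- **Row `643a1` `(p, d_K, ℓ) = (5, -8, 149)`, POINT-CERTIFICATE form:** for `d_K = -8`, a frame and a
tower `d m` (`m ∣ 149`) of Kolyvagin–Heegner data, `P(149) ∉ 5·E(K[149])` ⟹ `c_1(149) ≠ 0` (the bit of
`C643a1.depthRow_5_neg8_149` / `.kolyvaginDepthSupply_clause`; side conditions: kernel theorems of the row files).
[cite: JetchevLauterStein2009, §3.2 and §3.6 (arXiv:0707.0032)] [cite: McCallumLMS1991, §4 Cor. 4.5] -/
theorem kolyvaginClass_ne_zero_of_tower (K : Type) [Field K] [NumberField K]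
    (hK : IsImaginaryQuadratic K) (hD : NumberField.discr K = -8) :
    haveI := isElliptic_c643a1;
    haveI := isGloballyMinimal_c643a1;
    haveI : NeZero (((⟨1, 0, 0, -4, 3⟩ : WeierstrassCurve ℤ).map (Int.castRingHom ℚ)).conductorNorm ℤ) := neZero_conductorNorm_of_isElliptic _;
    ∀ (Dt : ModularParametrizationData ((⟨1, 0, 0, -4, 3⟩ : WeierstrassCurve ℤ).map (Int.castRingHom ℚ)) (((⟨1, 0, 0, -4, 3⟩ : WeierstrassCurve ℤ).map (Int.castRingHom ℚ)).conductorNorm ℤ)) (β : ℤ)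
    (ι : K →+* ℂ) (d : (m : ℕ) → m ∣ 149 → KolyvaginHeegnerData Dt β ι m),
    ¬ Koly.PDiv (d 149 dvd_rfl) 5 1 → (d 149 dvd_rfl).kolyvaginClass (p := 5) (by norm_num) 1 ≠ 0 := by
  haveI := isElliptic_c643a1
  haveI := isGloballyMinimal_c643a1
  haveI : NeZero (((⟨1, 0, 0, -4, 3⟩ : WeierstrassCurve ℤ).map (Int.castRingHom ℚ)).conductorNorm ℤ) := neZero_conductorNorm_of_isElliptic _
  intro Dt β ι d hcert
  haveI := Fact.mk (by norm_num : Nat.Prime 5)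
  exact kolyvaginClass_ne_zero_of_intModel_certificate_of_tower intModel 5 (by norm_num) hasSurjectiveModNGaloisRep_5 K hK
    hD (by norm_num) heegner_neg8 149 (by norm_num) (by norm_num) (by decide +kernel) (by norm_num) (by norm_num) (by norm_num) (by norm_num)
    (n := 135) card_149 (by norm_num) Dt β ι d hcert

end C643a1

/-! ## §3 Example `389a1`: the composed row and clause from the point certificate -/

namespace C389a1

/-- **Row `389a1` from the point certificate** (`depthRow_5_neg7_19` ∘ `kolyvaginClass_ne_zero_of_tower`):
`P(19) ∉ 5·E(K[19])` ⟹ `corank_ℤ5 Ш(E)[5^∞] = 0 ∧ rank = 2 ∧ s_5 = 2 ∧ s_5(E^(-7)) = 1`, modulo `hF`.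
BSD is not proved by it. [cite: Kolyvagin1991MathAnn, §2 Thm. 4] [cite: JetchevLauterStein2009, §3.6 (arXiv:0707.0032)] -/
theorem depthRow_5_neg7_19_of_tower (hF : Kolyvagin1991_selmerCorank_of_kolyvaginClass_ne_zero)
    (K : Type) [Field K] [NumberField K] (hK : IsImaginaryQuadratic K)
    (hD : NumberField.discr K = -7) :
    haveI := curve389a1_isGloballyMinimal;
    haveI := curve389a1_neZero_conductorNorm;
    ∀ (Dt : ModularParametrizationData Curve389a1.E (Curve389a1.E.conductorNorm ℤ)) (β : ℤ)
    (ι : K →+* ℂ) (d : (m : ℕ) → m ∣ 19 → KolyvaginHeegnerData Dt β ι m),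
    ¬ Koly.PDiv (d 19 dvd_rfl) 5 1 →
    Curve389a1.E.shaCorank 5 = 0 ∧ Curve389a1.E.mordellWeilRank = 2 ∧
      Curve389a1.E.selmerCorank 5 = 2 ∧
      (Curve389a1.E.quadraticTwist ((-7 : ℤ) : ℚ)).selmerCorank 5 = 1 := by
  haveI := curve389a1_isGloballyMinimal
  haveI := curve389a1_neZero_conductorNorm
  intro Dt β ι d hcert
  exact depthRow_5_neg7_19 hF K hK hD Dt β ι (d 19 dvd_rfl)
    (kolyvaginClass_ne_zero_of_tower K hK hD Dt β ι d hcert)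

/-- **The crux `KolyvaginDepthSupply` RESTRICTED TO `389a1` from the point certificate**
(`kolyvaginDepthSupply_clause` ∘ `kolyvaginClass_ne_zero_of_tower`): `P(19) ∉ 5·E(K[19])` for one
tower on one frame ⟹ the clause of the crux at `389a1`, verbatim, modulo `hF`. BSD is not proved by it.
[cite: Kolyvagin1991MathAnn, §2 Thm. 4] [cite: WZhang2014, Thm. 11.2 (i)] -/
theorem kolyvaginDepthSupply_clause_of_tower (hF : Kolyvagin1991_selmerCorank_of_kolyvaginClass_ne_zero)
    (K : Type) [Field K] [NumberField K] (hK : IsImaginaryQuadratic K)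
    (hD : NumberField.discr K = -7) :
    haveI := curve389a1_isGloballyMinimal;
    haveI := curve389a1_neZero_conductorNorm;
    ∀ (Dt : ModularParametrizationData Curve389a1.E (Curve389a1.E.conductorNorm ℤ)) (β : ℤ)
    (ι : K →+* ℂ) (d : (m : ℕ) → m ∣ 19 → KolyvaginHeegnerData Dt β ι m),
    ¬ Koly.PDiv (d 19 dvd_rfl) 5 1 →
    ∃ (p : ℕ) (hp : Fact p.Prime), 5 ≤ p ∧ Curve389a1.E.HasGoodReductionAtPrime p ∧ ¬ (p : ℤ) ∣
      Curve389a1.E.frobeniusTrace p ∧ Curve389a1.E.HasSurjectiveModNGaloisRep p ∧ ∃ (K : Type) (_ : Field K) (_ :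
      NumberField K), Literature.NumberTheory.EllipticCurves.IsImaginaryQuadratic K ∧
      NumberField.discr K ≠ -3 ∧ NumberField.discr K ≠ -4 ∧ ¬ ((p : ℤ) ∣ NumberField.discr K) ∧ ¬ (p
      ∣ Curve389a1.E.conductorNorm ℤ) ∧ ∃ (_ : NeZero (Curve389a1.E.conductorNorm ℤ)),
      Literature.NumberTheory.EllipticCurves.SatisfiesHeegnerHypothesis (Curve389a1.E.conductorNorm ℤ) K ∧ ∃
      (Dt : Literature.NumberTheory.EllipticCurves.ModularForms.ModularParametrizationData Curve389a1.E
      (Curve389a1.E.conductorNorm ℤ)) (β : ℤ) (ι : K →+* ℂ) (n : ℕ) (d :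
      Literature.NumberTheory.EllipticCurves.KolyvaginHeegnerData Dt β ι n) (M : ℕ),
      Literature.NumberTheory.EllipticCurves.KolyvaginDescent.KolSupp
      (Literature.NumberTheory.EllipticCurves.Zhang2014.IsKolyvaginPrime (Curve389a1.E.conductorNorm ℤ) Curve389a1.E K p)
      n ∧ 1 ≤ M ∧ (M : ℕ∞) ≤ Literature.NumberTheory.EllipticCurves.Zhang2014.levelIndex Curve389a1.E p n ∧
      d.kolyvaginClass hp.out M ≠ 0 ∧ (∀ (n' : ℕ) (d' :
      Literature.NumberTheory.EllipticCurves.KolyvaginHeegnerData Dt β ι n') (M' : ℕ),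
      Literature.NumberTheory.EllipticCurves.KolyvaginDescent.KolSupp
      (Literature.NumberTheory.EllipticCurves.Zhang2014.IsKolyvaginPrime (Curve389a1.E.conductorNorm ℤ) Curve389a1.E K p)
      n' → 1 ≤ M' → (M' : ℕ∞) ≤ Literature.NumberTheory.EllipticCurves.Zhang2014.levelIndex Curve389a1.E p n' →
      d'.kolyvaginClass hp.out M' ≠ 0 → n.primeFactors.card ≤ n'.primeFactors.card) ∧
      ((n.primeFactors.card + 1 = Curve389a1.E.mordellWeilRank ∧ (Curve389a1.E.quadraticTwist (NumberField.discr K :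
      ℚ)).mordellWeilRank < Curve389a1.E.mordellWeilRank) ∨ (n.primeFactors.card = Curve389a1.E.mordellWeilRank ∧
      (Curve389a1.E.quadraticTwist (NumberField.discr K : ℚ)).mordellWeilRank = Curve389a1.E.mordellWeilRank + 1)) := by
  haveI := curve389a1_isGloballyMinimal
  haveI := curve389a1_neZero_conductorNorm
  intro Dt β ι d hcert
  exact kolyvaginDepthSupply_clause hF K hK hD Dt β ι (d 19 dvd_rfl)
    (kolyvaginClass_ne_zero_of_tower K hK hD Dt β ι d hcert)

end C389a1

end Summit.BirchSwinnertonDyer.BirchSwinnertonDyer.Theorems.KolyvaginDepthDoor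

end
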